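import Literature.Geometry.Lorentzian.KissingBallsCutMass
import Literature.Geometry.Lorentzian.KasnerTrappedSphere
import Literature.Geometry.Lorentzian.MetricValCongr
import Literature.Geometry.Riemannian.RoundSphere
import Literature.Geometry.Riemannian.RicciFlowScaling
import Literature.Geometry.Riemannian.ChangGurskyYangProofs
import HarnessLib

/-!
# Crux `HorizonlessMustDrain` (stmt-FinalStateConjecture-9976), line `birth`, sanity tier —
# S4: the Gauss curvature of the round section of radius `r` of the Minkowski light cone is `1/r²`

Stub `stub_minkowskiSectionGauss` of the skeleton
`Cruxes/HorizonlessMustDrain/Lines/birth.lean` (sanity tier: the round sections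
`S_r = {(r, r y) : y ∈ S²}` of the light cone `∂J⁺({0})` of the Minkowski development
`Literature.Geometry.Lorentzian.Minkowski.vacuumCauchyDevelopment` form a round receding family of
Hawking mass `0`).  For `r > 0` and any proof `hf` that the section map
`y ↦ (r, r y) : S² → ℝ⁴` is a spacelike immersion for `η`, the Gauss curvature
(`LorentzianMetric.gaussCurvature = Scal(f^* η) / 2`, `CutBondiMass.lean`) of the section is `1/r²`
at every point.

Proof.  The differential of `y ↦ (r, r y)` is `v ↦ r (0, dι v)` (`dι = Kasner.dS` the
differential of the inclusion `S² ⊆ ℝ³`, `KasnerTrappedSphere.lean`), and `η((0, a), (0, b)) = ⟪a, b⟫`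
(`Minkowski.bilin_ofTimeSpace_zero`), so the induced metric `f^* η` has the same values as `r² ·`
the round metric of the unit sphere (`Literature.Geometry.Riemannian.roundMetric`,
`roundMetric_apply`; `PseudoRiemannianMetric.constSmul`).  Curvature quantities depend on the
values of the metric only (`PseudoRiemannianMetric.scalarCurvature_congr_of_val_eq`), constant
rescaling by `c` divides the scalar curvature by `c` (`PseudoRiemannianMetric.scalarCurvature_constSmul`),
and the round unit `2`-sphere has scalar curvature `2 · (2 - 1) = 2` (`scalarCurvature_roundMetric`);
hence `K = (r²)⁻¹ · 2 / 2 = 1/r²`.  O'Neill 1983, Ch. 3, Def. 3.53 and Ch. 4, Lemma 4.27 (round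
spheres are totally umbilic hypersurfaces of curvature `1/r²`); Lee 2018, Prop. 8.36.

Helper lemmas live in the sub-namespace `StubMinkowskiSectionGauss`; the file proves no route item
(`--supports stmt-FinalStateConjecture-9976`).  Typing: the carrier of the Minkowski development is
`E4`, its model `𝓡 (3 + 1) = 𝓘(ℝ, E4)` and its metric `η = Minkowski.bilin` at every point, each by
`rfl` only; the one `show` below performs these conversions.  The `Fact (finrank ℝ E3 = 2 + 1)`
through which the round metric sees `S² ⊆ ℝ³` is `Kasner.factFinrankE3`, supplied by `haveI`
(never as an instance attribute).
-/

noncomputable section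

open Bundle Set Metric Module Literature.Geometry.Lorentzian Literature.Geometry.Riemannian
open scoped Manifold ContDiff Topology RealInnerProductSpace

namespace Summit.FinalStateConjecture.FinalStateConjecture.Theorems.BondiDrainDispersalHorizonlessMustDrain

-- D-0017: single-problem summit, `Summit.<S>.<S>.…` by design.
set_option linter.dupNamespace false

namespace StubMinkowskiSectionGauss

/-- **The differential of the round section** `y ↦ (r, r y)` of the light cone at `y ∈ S²` is
`v ↦ r · (0, dι_y v)`, `dι_y = Kasner.dS y` the differential of the inclusion `S² ⊆ ℝ³` (chain
rule: the ambient map `z ↦ (r, r z) = r ∂ₜ + r (0, z)` is affine with linear part `z ↦ r (0, z)`).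
O'Neill 1983, Ch. 4, p. 97 ff. [folklore] -/
theorem mfderiv_section_apply (r : ℝ) (y : sphere (0 : E3) 1) (v : TangentSpace (𝓡 2) y) :
    mfderiv (𝓡 2) 𝓘(ℝ, E4) (fun y : sphere (0 : E3) 1 ↦ E4.ofTimeSpace r (r • (y : E3))) y v =
      r • E4.ofTimeSpace 0 (Kasner.dS y v) := by
  -- the linear part `z ↦ r (0, z)` of the ambient affine map, as a continuous linear map
  obtain ⟨L, hL⟩ : ∃ L : E3 →L[ℝ] E4, ∀ z, L z = r • E4.ofTimeSpace 0 z :=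
    ⟨r • LinearMap.toContinuousLinearMap
        (IsLinearMap.mk' _ Minkowski.isLinearMap_ofTimeSpace_zero), fun _ ↦ rfl⟩
  have hfun : (fun z : E3 ↦ E4.ofTimeSpace r (r • z)) =
      fun z : E3 ↦ r • E4.basisVector 0 + L z := by
    funext z
    rw [hL, E4.ofTimeSpace_eq_smul_add, Minkowski.isLinearMap_ofTimeSpace_zero.map_smul]
  have hF : HasFDerivAt (fun z : E3 ↦ E4.ofTimeSpace r (r • z)) L (y : E3) := by
    rw [hfun]
    exact L.hasFDerivAt.const_add _
  have h : HasMFDerivAt (𝓡 2) 𝓘(ℝ, E4)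
      ((fun z : E3 ↦ E4.ofTimeSpace r (r • z)) ∘ (Subtype.val : sphere (0 : E3) 1 → E3)) y
      (L.comp (mfderiv (𝓡 2) 𝓘(ℝ, E3) (Subtype.val : sphere (0 : E3) 1 → E3) y)) :=
    hF.hasMFDerivAt.comp y (Kasner.mdifferentiableAt_coe_sphere y).hasMFDerivAt
  rw [← hL]
  exact congrArg (fun φ : TangentSpace (𝓡 2) y →L[ℝ] E4 ↦ φ v) h.mfderiv

/-- The round metric of the unit sphere `S² ⊆ ℝ³` on tangent vectors, `g_y(v, w) = ⟪dι_y v, dι_y w⟫`,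
with the inner product taken in `E3` itself (`roundMetric_apply` states it in the tangent space
`T_y E3 = E3` with its Riemannian-bundle inner product, the same number by `rfl`). O'Neill 1983,
Ch. 3, Def. 3.4 and p. 57. [folklore] -/
theorem roundMetric_apply_dS (y : sphere (0 : E3) 1) (v w : TangentSpace (𝓡 2) y) :
    (haveI := Kasner.factFinrankE3
     (roundMetric (n := 2) E3).val y v w) = ⟪Kasner.dS y v, Kasner.dS y w⟫ := by
  haveI := Kasner.factFinrankE3
  exact roundMetric_apply y v w

/-- **The induced metric of the round section of radius `r` is `r²` times the round metric**:
`(f^* η)_y = r² (g_{S²})_y` as bilinear forms on `T_y S²`, for `f y = (r, r y)` and `η` the metric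
of the Minkowski development (`η(r (0, dι v), r (0, dι w)) = r² ⟪dι v, dι w⟫`,
`Minkowski.bilin_ofTimeSpace_zero`, `roundMetric_apply`). O'Neill 1983, Ch. 3, p. 57 and Ch. 4,
p. 97 (the metric of `Sⁿ(r) ⊆ ℝⁿ⁺¹`). [folklore] -/
theorem inducedMetric_val_eq (r : ℝ) (hr : 0 < r)
    (hf : Minkowski.vacuumCauchyDevelopment.toCauchyDevelopment.metric.IsSpacelikeImmersion
      (𝓡 2) (fun y : sphere (0 : E3) 1 ↦ E4.ofTimeSpace r (r • (y : E3))))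
    (y : sphere (0 : E3) 1) :
    (Minkowski.vacuumCauchyDevelopment.toCauchyDevelopment.metric.inducedMetric
        (fun y : sphere (0 : E3) 1 ↦ E4.ofTimeSpace r (r • (y : E3)))
        PseudoRiemannianMetric.contMDiff_pullbackBilin_holds hf).val y =
      (haveI := Kasner.factFinrankE3
       ((roundMetric (n := 2) E3).constSmul (r ^ 2) (by positivity)).val y) := by
  ext v w
  rw [PseudoRiemannianMetric.inducedMetric_val, PseudoRiemannianMetric.inducedBilin_apply,
    PseudoRiemannianMetric.constSmul_apply, roundMetric_apply_dS]
  -- the metric of the development is `η` and its model is `𝓘(ℝ, E4)`, both by `rfl`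
  show Minkowski.bilin
      (mfderiv (𝓡 2) 𝓘(ℝ, E4) (fun y : sphere (0 : E3) 1 ↦ E4.ofTimeSpace r (r • (y : E3))) y v)
      (mfderiv (𝓡 2) 𝓘(ℝ, E4) (fun y : sphere (0 : E3) 1 ↦ E4.ofTimeSpace r (r • (y : E3))) y w) = _
  rw [mfderiv_section_apply, mfderiv_section_apply]
  simp only [map_smul, _root_.smul_apply, Minkowski.bilin_ofTimeSpace_zero, smul_eq_mul]
  ring

/-- **The scalar curvature of the round section of radius `r` is `2/r²`**, for any Levi-Civita
instance `hG` of the induced metric (all agree, `HasLeviCivita` being a proposition): the induced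
metric has the values of `r² g_{S²}` (`inducedMetric_val_eq`), curvature depends on the values only
(`scalarCurvature_congr_of_val_eq`), `Scal(c g) = c⁻¹ Scal(g)` (`scalarCurvature_constSmul`) and
`Scal(g_{S²}) = 2 · (2 - 1)` (`scalarCurvature_roundMetric`). Lee 2018, Prop. 8.36; O'Neill 1983,
Ch. 4, Lemma 4.27. [folklore] -/
theorem scalarCurvature_inducedMetric_eq (r : ℝ) (hr : 0 < r)
    (hf : Minkowski.vacuumCauchyDevelopment.toCauchyDevelopment.metric.IsSpacelikeImmersion
      (𝓡 2) (fun y : sphere (0 : E3) 1 ↦ E4.ofTimeSpace r (r • (y : E3))))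
    {hG : (Minkowski.vacuumCauchyDevelopment.toCauchyDevelopment.metric.inducedMetric
        (fun y : sphere (0 : E3) 1 ↦ E4.ofTimeSpace r (r • (y : E3)))
        PseudoRiemannianMetric.contMDiff_pullbackBilin_holds hf).HasLeviCivita}
    (y : sphere (0 : E3) 1) :
    (Minkowski.vacuumCauchyDevelopment.toCauchyDevelopment.metric.inducedMetric
        (fun y : sphere (0 : E3) 1 ↦ E4.ofTimeSpace r (r • (y : E3)))
        PseudoRiemannianMetric.contMDiff_pullbackBilin_holds hf).scalarCurvature y = 2 / r ^ 2 := by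
  haveI := Kasner.factFinrankE3
  have hr2 : r ^ 2 ≠ 0 := by positivity
  haveI : ((roundMetric (n := 2) E3).constSmul (r ^ 2) hr2).HasLeviCivita :=
    PseudoRiemannianMetric.hasLeviCivita _
  haveI : (roundMetric (n := 2) E3).HasLeviCivita := PseudoRiemannianMetric.hasLeviCivita _
  rw [PseudoRiemannianMetric.scalarCurvature_congr_of_val_eq (inducedMetric_val_eq r hr hf) y,
    PseudoRiemannianMetric.scalarCurvature_constSmul, scalarCurvature_roundMetric]
  rw [Nat.cast_ofNat, inv_mul_eq_div]
  norm_num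

end StubMinkowskiSectionGauss

open StubMinkowskiSectionGauss in
/-- **S4 — THE GAUSS CURVATURE OF THE SECTION OF RADIUS `r` IS `1/r²`.** For `r > 0` and any proof
`hf` that the round section `y ↦ (r, r y)` of the light cone of the origin is a spacelike immersion
into the Minkowski development, its Gauss curvature (`LorentzianMetric.gaussCurvature`, half the
scalar curvature of the induced metric) is `1/r²` at every `y ∈ S²`: the induced metric is `r² ·`
the round metric (`StubMinkowskiSectionGauss.inducedMetric_val_eq`), curvature depends on the
values of the metric only (`scalarCurvature_congr_of_val_eq`), rescaling by `r²` divides the scalar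
curvature by `r²` (`scalarCurvature_constSmul`) and the round unit `2`-sphere has scalar curvature
`2` (`scalarCurvature_roundMetric`). O'Neill 1983, Ch. 3, Def. 3.53 and Ch. 4, Lemma 4.27 (spheres
are totally umbilic of curvature `1/r²`); Lee 2018, Prop. 8.36. [folklore] -/
theorem stub_minkowskiSectionGauss : open scoped Manifold in
    ∀ r : ℝ, 0 < r →
      ∀ hf : Literature.Geometry.Lorentzian.Minkowski.vacuumCauchyDevelopment.toCauchyDevelopment.metric.IsSpacelikeImmersion
          (𝓡 2) (fun y : Metric.sphere (0 : Literature.Geometry.Lorentzian.E3) 1 ↦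
            Literature.Geometry.Lorentzian.E4.ofTimeSpace r (r • (y : Literature.Geometry.Lorentzian.E3))),
        ∀ y : Metric.sphere (0 : Literature.Geometry.Lorentzian.E3) 1,
          Literature.Geometry.Lorentzian.Minkowski.vacuumCauchyDevelopment.toCauchyDevelopment.metric.gaussCurvature
              (fun y : Metric.sphere (0 : Literature.Geometry.Lorentzian.E3) 1 ↦
                Literature.Geometry.Lorentzian.E4.ofTimeSpace r (r • (y : Literature.Geometry.Lorentzian.E3))) hf y =
            1 / r ^ 2 := by
  intro r hr hf y
  unfold LorentzianMetric.gaussCurvature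
  rw [scalarCurvature_inducedMetric_eq r hr hf y]
  ring

end Summit.FinalStateConjecture.FinalStateConjecture.Theorems.BondiDrainDispersalHorizonlessMustDrain

end
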